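import Literature.MathematicalPhysics.KineticTheory.LambertianRedrawNondegenerate
import Literature.MathematicalPhysics.KineticTheory.HardSphereEuler
import HarnessLib

/-!
# The fresh-tail (strong Markov) identity of the Lambertian hard-sphere flow
# (`LambertianContactSwap.LambertianEuler`, stmt-AtomisticToContinuum-11854, line `Sketch`;
# sub-goal `lambertFlow_freshTail` of the stub `stub_liouvilleInvariance`)

For the Lambertian (cosine-redraw) hard-sphere flow `Λ_t(z; ξs) = lambertFlow G ε ξs z t` of
`Literature.MathematicalPhysics.KineticTheory.LambertianHardSphereFlow`, driven by the i.i.d.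
Gaussian sequence `ξs ∼ lambertNoise = γ^ℕ`, the noise *not yet used* at time `t`, namely the
shifted sequence `n ↦ ξs (n + K_t)` with `K_t = lambertCount G ε ξs z t` the number of redraws in
`[0, t]`, is again `γ^ℕ`-distributed and independent of the state `Λ_t(z; ξs)` (a function of
`ξs 0, …, ξs (K_t - 1)` and of the event `{K_t = k}`). We state and prove this as the Tonelli
identity `lambertFlow_freshTail`:
`∫ H(Λ_t, ξs (· + K_t)) dγ^ℕ = ∫ (∫ H(Λ_t, ηs) dγ^ℕ(ηs)) dγ^ℕ` for measurable `H ≥ 0`, a fixed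
datum `z`, `t ≥ 0`, under almost-sure non-accumulation of the collision instants before `t` (on
the Zeno set `lambertCount` is the junk value `0`).

Proof: split the integrand over the events `{K_t = n}` (`tsum_ite_eq'`, `lintegral_tsum`) and
prove the identity on each piece by induction on `n` *uniformly in the datum and the time*
(`lintegral_piece_fresh`): if `t < τ(z)` no redraw happens (`K_t = 0`, `Λ_t = S_t z` whatever the
noise) and the piece `n = 0` is Fubini for a constant; if `τ(z) ≤ t` the restart identities after
the first collision (`lambertCount_eq_lambertCount_lambertStep_succ`,
`lambertFlow_eq_lambertFlow_lambertStep`: `K_t(z; ξs) = K_{t-τ}(L_{ξs 0} z; ξs ∘ succ) + 1`,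
`Λ_t(z; ξs) = Λ_{t-τ}(L_{ξs 0} z; ξs ∘ succ)`) and Tonelli over the head/tail decomposition
`γ^ℕ ≅ γ ⊗ γ^ℕ` (`lambertNoise_map_headTail`, here `lintegral_headTail`) reduce the piece `n + 1`
at `(z, t)` to the piece `n` at `(L_ξ z, t - τ(z))`, averaged over the first redraw `ξ ∼ γ`
(`lintegral_piece_restart`); the non-accumulation hypothesis transfers to the restarted data for
`γ`-a.e. `ξ` (`ae_nonaccumulation_restart`). All [folklore] (the strong Markov property of a
sequence of i.i.d. redraws read at a stopping index); nothing is redefined, no named fact is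
introduced.
-/

noncomputable section

open scoped BigOperators Topology ENNReal InnerProductSpace
open MeasureTheory ProbabilityTheory Filter Set
open Literature.MathematicalPhysics.KineticTheory
open Literature.Analysis.FluidPDE Literature.Analysis.FluidPDE.Alexander

namespace Summit.AtomisticToContinuum.HydrodynamicLimit.Theorems.LambertianContactSwapLambertianEulerFreshTail

variable {N : ℕ} {G : Geometry (Fin 3) T3} {ε : ℝ}

/-! ## Tonelli over the first redraw; measurability of the shifted noise and the restarted data -/

/-- **Tonelli over the first redraw** on `ℝ³`: a `lintegral` against `γ^ℕ = lambertNoise (Fin 3)`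
of a measurable function of (head, tail) is the iterated `lintegral` against `γ = stdGaussian V3`
and `γ^ℕ` (`lambertNoise_map_headTail`: `γ^ℕ ≅ γ ⊗ γ^ℕ`; the `d = Fin 3` instance of
`…LambertianEulerMomentLedgerChain.lintegral_lambertNoise_headTail`, kept local to keep the import
closure of this file small). [folklore] -/
private theorem lintegral_headTail {P : V3 × (ℕ → V3) → ℝ≥0∞} (hP : Measurable P) :
    ∫⁻ ξs, P (ξs 0, fun m => ξs (m + 1)) ∂(lambertNoise (Fin 3)) =
      ∫⁻ ξ, ∫⁻ ξs, P (ξ, ξs) ∂(lambertNoise (Fin 3)) ∂(stdGaussian V3) := by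
  rw [← lintegral_prod _ hP.aemeasurable, ← lambertNoise_map_headTail (Fin 3),
    lintegral_map hP ((measurable_pi_apply 0).prodMk (measurable_tail (Fin 3)))]

/-- Reading a measurable noise sequence from a measurable random index on is again a measurable
sequence: `a ↦ (m ↦ ξs a (m + K a))` (the index takes countably many values). [folklore] -/
theorem measurable_shift {α : Type*} [MeasurableSpace α] {K : α → ℕ} (hK : Measurable K)
    {ξs : α → ℕ → V3} (hξs : Measurable ξs) : Measurable fun a => fun m => ξs a (m + K a) := by
  refine measurable_pi_lambda _ fun m => ?_
  have h : (fun a => ξs a (m + K a)) =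
      (fun p : (ℕ → V3) × ℕ => p.1 (m + p.2)) ∘ fun a => (ξs a, K a) := rfl
  rw [h]
  exact (measurable_from_prod_countable_left fun k => measurable_pi_apply (m + k)).comp
    (hξs.prodMk hK)

/-- A piece `a ↦ if K a = n then f a else 0` of a measurable `f` cut by a measurable index `K` is
measurable. [folklore] -/
theorem measurable_piece {α : Type*} [MeasurableSpace α] {K : α → ℕ} (hK : Measurable K) (n : ℕ)
    {f : α → ℝ≥0∞} (hf : Measurable f) : Measurable fun a => if K a = n then f a else 0 :=
  Measurable.ite (hK (measurableSet_singleton n)) hf measurable_const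

/-- For a fixed datum the collision count `ξs ↦ K_t(z; ξs)` is measurable in the noise.
[folklore] -/
theorem measurable_lambertCount_right (hG : G.IsHardSphereRegular ε) (hGm : G.IsMeasurable)
    (z : Config N (Fin 3) T3) (t : ℝ) :
    Measurable fun ξs : ℕ → V3 => lambertCount G ε ξs z t := by
  have h : (fun ξs : ℕ → V3 => lambertCount G ε ξs z t) =
      (fun p : Config N (Fin 3) T3 × (ℕ → V3) => lambertCount G ε p.2 p.1 t) ∘ fun ξs => (z, ξs) :=
    rfl
  rw [h]
  exact (measurable_lambertCount hG hGm t).comp (measurable_const.prodMk measurable_id)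

/-- The restarted datum/noise pair `(ξ, ξs) ↦ (L_ξ z, ξs)` is measurable. [folklore] -/
theorem measurable_restart (hG : G.IsHardSphereRegular ε) (hGm : G.IsMeasurable)
    (z : Config N (Fin 3) T3) :
    Measurable fun q : V3 × (ℕ → V3) => (lambertStep G ε q.1 z, q.2) :=
  (measurable_lambertStep_comp hG hGm measurable_const measurable_fst).prodMk measurable_snd

/-- The collision count of the restarted data is measurable in `(ξ, ξs)`. [folklore] -/
theorem measurable_lambertCount_restart (hG : G.IsHardSphereRegular ε) (hGm : G.IsMeasurable)
    (z : Config N (Fin 3) T3) (t : ℝ) :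
    Measurable fun q : V3 × (ℕ → V3) => lambertCount G ε q.2 (lambertStep G ε q.1 z) t := by
  have h : (fun q : V3 × (ℕ → V3) => lambertCount G ε q.2 (lambertStep G ε q.1 z) t) =
      (fun p : Config N (Fin 3) T3 × (ℕ → V3) => lambertCount G ε p.2 p.1 t) ∘
        fun q : V3 × (ℕ → V3) => (lambertStep G ε q.1 z, q.2) := rfl
  rw [h]
  exact (measurable_lambertCount hG hGm t).comp (measurable_restart hG hGm z)

/-- The flow of the restarted data is measurable in `(ξ, ξs)`. [folklore] -/
theorem measurable_lambertFlow_restart (hG : G.IsHardSphereRegular ε) (hGm : G.IsMeasurable)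
    (z : Config N (Fin 3) T3) (t : ℝ) :
    Measurable fun q : V3 × (ℕ → V3) => lambertFlow G ε q.2 (lambertStep G ε q.1 z) t := by
  have h : (fun q : V3 × (ℕ → V3) => lambertFlow G ε q.2 (lambertStep G ε q.1 z) t) =
      (fun p : Config N (Fin 3) T3 × (ℕ → V3) => lambertFlow G ε p.2 p.1 t) ∘
        fun q : V3 × (ℕ → V3) => (lambertStep G ε q.1 z, q.2) := rfl
  rw [h]
  exact (measurable_lambertFlow hG hGm t).comp (measurable_restart hG hGm z)

/-- The instants of the restarted data are measurable in `(ξ, ξs)`. [folklore] -/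
theorem measurable_lambertInstant_restart (hG : G.IsHardSphereRegular ε) (hGm : G.IsMeasurable)
    (z : Config N (Fin 3) T3) (k : ℕ) :
    Measurable fun q : V3 × (ℕ → V3) => lambertInstant G ε q.2 (lambertStep G ε q.1 z) k := by
  have h : (fun q : V3 × (ℕ → V3) => lambertInstant G ε q.2 (lambertStep G ε q.1 z) k) =
      (fun p : Config N (Fin 3) T3 × (ℕ → V3) => lambertInstant G ε p.2 p.1 k) ∘
        fun q : V3 × (ℕ → V3) => (lambertStep G ε q.1 z, q.2) := rfl
  rw [h]
  exact (measurable_lambertInstant hG hGm k).comp (measurable_restart hG hGm z)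

/-! ## Restart after the first collision: non-accumulation and the pieces `{K_t = n + 1}` -/

/-- **Non-accumulation transfers to the restarted data**: if `τ(z) ≤ t`, `τ(z) < ∞` and for
`γ^ℕ`-a.e. `ξs` some instant of `(z, ξs)` exceeds `t`, then for `γ`-a.e. first redraw `ξ` and
`γ^ℕ`-a.e. `ξs`, some instant of `(L_ξ z, ξs)` exceeds `t - τ(z)` (restart of the instants
`lambertInstant_succ_eq_tail` and `γ^ℕ ≅ γ ⊗ γ^ℕ`). [folklore] -/
theorem ae_nonaccumulation_restart (hG : G.IsHardSphereRegular ε) (hGm : G.IsMeasurable)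
    {z : Config N (Fin 3) T3} {t : ℝ} (hτ : freeExitTime G ε z ≠ ∞)
    (hτt : freeExitTime G ε z ≤ ENNReal.ofReal t)
    (hgood : ∀ᵐ ξs ∂(lambertNoise (Fin 3)), ∃ k, ENNReal.ofReal t < lambertInstant G ε ξs z k) :
    ∀ᵐ ξ ∂(stdGaussian V3), ∀ᵐ ξs ∂(lambertNoise (Fin 3)), ∃ k,
      ENNReal.ofReal (t - (freeExitTime G ε z).toReal) <
        lambertInstant G ε ξs (lambertStep G ε ξ z) k := by
  have hS : MeasurableSet {q : V3 × (ℕ → V3) | ∃ k,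
      ENNReal.ofReal (t - (freeExitTime G ε z).toReal) <
        lambertInstant G ε q.2 (lambertStep G ε q.1 z) k} :=
    measurableSet_setOf.2 (Measurable.exists fun k => measurableSet_setOf.1
      (measurableSet_lt measurable_const (measurable_lambertInstant_restart hG hGm z k)))
  have h1 : ∀ᵐ ξs ∂(lambertNoise (Fin 3)), ∃ k,
      ENNReal.ofReal (t - (freeExitTime G ε z).toReal) <
        lambertInstant G ε (fun m => ξs (m + 1)) (lambertStep G ε (ξs 0) z) k := by
    filter_upwards [hgood] with ξs hξs
    obtain ⟨k, hk⟩ := hξs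
    cases k with
    | zero => simp at hk
    | succ k =>
      rw [lambertInstant_succ_eq_tail, ofReal_eq_add_ofReal_sub_toReal hτ hτt] at hk
      exact ⟨k, (ENNReal.add_lt_add_iff_left hτ).1 hk⟩
  have h2 : ∀ᵐ q ∂((stdGaussian V3).prod (lambertNoise (Fin 3))), ∃ k,
      ENNReal.ofReal (t - (freeExitTime G ε z).toReal) <
        lambertInstant G ε q.2 (lambertStep G ε q.1 z) k := by
    rw [← lambertNoise_map_headTail (Fin 3)]
    exact (ae_map_iff ((measurable_pi_apply 0).prodMk (measurable_tail (Fin 3))).aemeasurable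
      hS).2 h1
  exact Measure.ae_ae_of_ae_prod h2

/-- **Restart of the piece `{K_t = n + 1}`**: for a measurable functional `Φ ≥ 0` of
(state, noise sequence), if `τ(z) ≤ t`, `τ(z) < ∞` and the instants of `(z, ξs)` a.s. exceed `t`
somewhere, then the `γ^ℕ`-integral of `1{K_t(z;ξs) = n+1} Φ(Λ_t(z;ξs), ξs (· + K_t))` is the
`γ ⊗ γ^ℕ`-integral of `1{K_{t'}(L_ξ z; ξs) = n} Φ(Λ_{t'}(L_ξ z; ξs), ξs (· + K_{t'}))`,
`t' = t - τ(z)` — the restart identities `lambertCount_eq_lambertCount_lambertStep_succ`,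
`lambertFlow_eq_lambertFlow_lambertStep` and Tonelli over `γ^ℕ ≅ γ ⊗ γ^ℕ`. [folklore] -/
theorem lintegral_piece_restart (hG : G.IsHardSphereRegular ε) (hGm : G.IsMeasurable)
    {Φ : Config N (Fin 3) T3 × (ℕ → V3) → ℝ≥0∞} (hΦ : Measurable Φ) (n : ℕ)
    {z : Config N (Fin 3) T3} {t : ℝ} (hτ : freeExitTime G ε z ≠ ∞)
    (hτt : freeExitTime G ε z ≤ ENNReal.ofReal t)
    (hgood : ∀ᵐ ξs ∂(lambertNoise (Fin 3)), ∃ k, ENNReal.ofReal t < lambertInstant G ε ξs z k) :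
    ∫⁻ ξs, (if lambertCount G ε ξs z t = n + 1 then
        Φ (lambertFlow G ε ξs z t, fun m => ξs (m + lambertCount G ε ξs z t)) else 0)
        ∂(lambertNoise (Fin 3)) =
      ∫⁻ ξ, ∫⁻ ξs, (if lambertCount G ε ξs (lambertStep G ε ξ z)
          (t - (freeExitTime G ε z).toReal) = n then
        Φ (lambertFlow G ε ξs (lambertStep G ε ξ z) (t - (freeExitTime G ε z).toReal),
          fun m => ξs (m + lambertCount G ε ξs (lambertStep G ε ξ z)
            (t - (freeExitTime G ε z).toReal))) else 0)
        ∂(lambertNoise (Fin 3)) ∂(stdGaussian V3) := by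
  have hP : Measurable fun q : V3 × (ℕ → V3) =>
      if lambertCount G ε q.2 (lambertStep G ε q.1 z) (t - (freeExitTime G ε z).toReal) = n then
        Φ (lambertFlow G ε q.2 (lambertStep G ε q.1 z) (t - (freeExitTime G ε z).toReal),
          fun m => q.2 (m + lambertCount G ε q.2 (lambertStep G ε q.1 z)
            (t - (freeExitTime G ε z).toReal))) else 0 :=
    measurable_piece (measurable_lambertCount_restart hG hGm z _) n
      (hΦ.comp ((measurable_lambertFlow_restart hG hGm z _).prodMk
        (measurable_shift (measurable_lambertCount_restart hG hGm z _) measurable_snd)))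
  refine (lintegral_congr_ae ?_).trans (lintegral_headTail hP)
  filter_upwards [hgood] with ξs hξs
  have key : ∀ (K : ℕ) (w : Config N (Fin 3) T3),
      (if K + 1 = n + 1 then Φ (w, fun m => ξs (m + (K + 1))) else 0) =
        if K = n then Φ (w, fun m => ξs (m + K + 1)) else 0 := by
    intro K w
    simp only [Nat.add_right_cancel_iff, Nat.add_assoc]
  rw [lambertCount_eq_lambertCount_lambertStep_succ hτ hτt hξs,
    lambertFlow_eq_lambertFlow_lambertStep hτ hτt hξs]
  exact key _ _

/-! ## The pieces `{K_t = n}`, by induction on `n` uniformly in the datum and the time -/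

/-- **The fresh-tail identity on the piece `{K_t = n}`**, for every `n`, every datum `z` and
every `t ≥ 0` with a.s. non-accumulation before `t`:
`∫ 1{K_t = n} H(Λ_t, ξs (· + K_t)) dγ^ℕ = ∫ 1{K_t = n} (∫ H(Λ_t, ηs) dγ^ℕ(ηs)) dγ^ℕ`. Induction on
`n` generalizing `z, t`: before the first collision (`t < τ(z)`) nothing is random; past it, the
piece `n + 1` at `(z, t)` is the `γ`-average over the first redraw `ξ` of the piece `n` at
`(L_ξ z, t - τ(z))` (`lintegral_piece_restart`, applied to `H` and to `H̄(w, ·) = ∫ H(w, ηs) dηs`).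
[folklore] -/
theorem lintegral_piece_fresh (hG : G.IsHardSphereRegular ε) (hGm : G.IsMeasurable)
    {H : Config N (Fin 3) T3 × (ℕ → V3) → ℝ≥0∞} (hH : Measurable H) (n : ℕ) :
    ∀ (z : Config N (Fin 3) T3) (t : ℝ), 0 ≤ t →
      (∀ᵐ ξs ∂(lambertNoise (Fin 3)), ∃ k, ENNReal.ofReal t < lambertInstant G ε ξs z k) →
      ∫⁻ ξs, (if lambertCount G ε ξs z t = n then
          H (lambertFlow G ε ξs z t, fun m => ξs (m + lambertCount G ε ξs z t)) else 0)
          ∂(lambertNoise (Fin 3)) =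
        ∫⁻ ξs, (if lambertCount G ε ξs z t = n then
          ∫⁻ ηs, H (lambertFlow G ε ξs z t, ηs) ∂(lambertNoise (Fin 3)) else 0)
          ∂(lambertNoise (Fin 3)) := by
  have hHbar : Measurable fun p : Config N (Fin 3) T3 × (ℕ → V3) =>
      ∫⁻ ηs, H (p.1, ηs) ∂(lambertNoise (Fin 3)) :=
    hH.lintegral_prod_right'.comp measurable_fst
  induction n with
  | zero =>
    intro z t ht hgood
    by_cases hlt : ENNReal.ofReal t < freeExitTime G ε z
    · -- before the first collision: no redraw, `Λ_t = S_t z` whatever the noise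
      have hK : ∀ ξs : ℕ → V3, lambertCount G ε ξs z t = 0 := fun _ =>
        lambertCount_eq_zero_of_lt hlt
      have hΛ : ∀ ξs : ℕ → V3, lambertFlow G ε ξs z t = freeFlight G t z := fun _ =>
        lambertFlow_eq_freeFlight_of_lt hlt
      simp only [hK, hΛ, ite_true, Nat.add_zero, lintegral_const, measure_univ, mul_one]
    · -- past the first collision: a.s. at least one redraw, the piece is empty
      have hτt : freeExitTime G ε z ≤ ENNReal.ofReal t := not_lt.1 hlt
      have hτ : freeExitTime G ε z ≠ ∞ := ne_top_of_le_ne_top ENNReal.ofReal_ne_top hτt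
      refine lintegral_congr_ae ?_
      filter_upwards [hgood] with ξs hξs
      rw [lambertCount_eq_lambertCount_lambertStep_succ hτ hτt hξs, if_neg (Nat.add_one_ne_zero _),
        if_neg (Nat.add_one_ne_zero _)]
  | succ n ih =>
    intro z t ht hgood
    by_cases hlt : ENNReal.ofReal t < freeExitTime G ε z
    · -- before the first collision: the piece `n + 1` is empty
      refine lintegral_congr_ae (Eventually.of_forall fun ξs => ?_)
      dsimp only
      rw [lambertCount_eq_zero_of_lt hlt, if_neg (Nat.zero_ne_add_one n),
        if_neg (Nat.zero_ne_add_one n)]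
    · -- past the first collision: restart at `L_ξ z`, time `t - τ(z)`, and use the piece `n`
      have hτt : freeExitTime G ε z ≤ ENNReal.ofReal t := not_lt.1 hlt
      have hτ : freeExitTime G ε z ≠ ∞ := ne_top_of_le_ne_top ENNReal.ofReal_ne_top hτt
      have ht' : 0 ≤ t - (freeExitTime G ε z).toReal :=
        sub_nonneg.2 (ENNReal.toReal_le_of_le_ofReal ht hτt)
      refine (lintegral_piece_restart hG hGm hH n hτ hτt hgood).trans
        (Eq.trans ?_ (lintegral_piece_restart hG hGm hHbar n hτ hτt hgood).symm)
      refine lintegral_congr_ae ?_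
      filter_upwards [ae_nonaccumulation_restart hG hGm hτ hτt hgood] with ξ hξ
      exact ih (lambertStep G ε ξ z) _ ht' hξ

/-! ## Main statement -/

/-- **Fresh tail of the Lambertian noise at the collision count (strong Markov property of the
i.i.d. redraws, Tonelli form).** For a regular measurable geometry `G` on `𝕋³`, a measurable
`H ≥ 0` on (state, noise sequence), a datum `z` and `t ≥ 0` such that for `γ^ℕ`-a.e. `ξs` the
collision instants of `(z, ξs)` do not accumulate before `t`:
`∫ H(Λ_t(z;ξs), ξs (· + K_t(z;ξs))) dγ^ℕ(ξs) = ∫ (∫ H(Λ_t(z;ξs), ηs) dγ^ℕ(ηs)) dγ^ℕ(ξs)`, i.e. the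
noise not yet consumed at time `t` is a fresh `γ^ℕ` sequence independent of `Λ_t(z; ξs)`. Sum of
`lintegral_piece_fresh` over the pieces `{K_t = n}` (`tsum_ite_eq'`, `lintegral_tsum`).
[folklore] -/
theorem lambertFlow_freshTail :
    ∀ {N : ℕ} {G : Geometry (Fin 3) T3} {ε : ℝ}, G.IsHardSphereRegular ε → G.IsMeasurable →
    ∀ {H : Config N (Fin 3) T3 × (ℕ → V3) → ℝ≥0∞}, Measurable H →
    ∀ (z : Config N (Fin 3) T3) (t : ℝ), 0 ≤ t →
      (∀ᵐ ξs ∂(lambertNoise (Fin 3)), ∃ k, ENNReal.ofReal t < lambertInstant G ε ξs z k) →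
      ∫⁻ ξs, H (lambertFlow G ε ξs z t, fun n => ξs (n + lambertCount G ε ξs z t))
          ∂(lambertNoise (Fin 3)) =
        ∫⁻ ξs, (∫⁻ ηs, H (lambertFlow G ε ξs z t, ηs) ∂(lambertNoise (Fin 3)))
          ∂(lambertNoise (Fin 3)) := by
  intro N G ε hG hGm H hH z t ht hgood
  have hK : Measurable fun ξs : ℕ → V3 => lambertCount G ε ξs z t :=
    measurable_lambertCount_right hG hGm z t
  have hf : Measurable fun ξs : ℕ → V3 =>
      H (lambertFlow G ε ξs z t, fun n => ξs (n + lambertCount G ε ξs z t)) :=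
    hH.comp ((measurable_lambertFlow_right hG hGm z t).prodMk (measurable_shift hK measurable_id))
  have hg : Measurable fun ξs : ℕ → V3 =>
      ∫⁻ ηs, H (lambertFlow G ε ξs z t, ηs) ∂(lambertNoise (Fin 3)) :=
    hH.lintegral_prod_right'.comp (measurable_lambertFlow_right hG hGm z t)
  calc ∫⁻ ξs, H (lambertFlow G ε ξs z t, fun n => ξs (n + lambertCount G ε ξs z t))
        ∂(lambertNoise (Fin 3))
      = ∫⁻ ξs, ∑' n : ℕ, (if lambertCount G ε ξs z t = n then
          H (lambertFlow G ε ξs z t, fun m => ξs (m + lambertCount G ε ξs z t)) else 0)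
          ∂(lambertNoise (Fin 3)) :=
        lintegral_congr fun ξs => (tsum_ite_eq' (lambertCount G ε ξs z t) fun _ =>
          H (lambertFlow G ε ξs z t, fun m => ξs (m + lambertCount G ε ξs z t))).symm
    _ = ∑' n : ℕ, ∫⁻ ξs, (if lambertCount G ε ξs z t = n then
          H (lambertFlow G ε ξs z t, fun m => ξs (m + lambertCount G ε ξs z t)) else 0)
          ∂(lambertNoise (Fin 3)) :=
        lintegral_tsum fun n => (measurable_piece hK n hf).aemeasurable
    _ = ∑' n : ℕ, ∫⁻ ξs, (if lambertCount G ε ξs z t = n then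
          ∫⁻ ηs, H (lambertFlow G ε ξs z t, ηs) ∂(lambertNoise (Fin 3)) else 0)
          ∂(lambertNoise (Fin 3)) :=
        tsum_congr fun n => lintegral_piece_fresh hG hGm hH n z t ht hgood
    _ = ∫⁻ ξs, ∑' n : ℕ, (if lambertCount G ε ξs z t = n then
          ∫⁻ ηs, H (lambertFlow G ε ξs z t, ηs) ∂(lambertNoise (Fin 3)) else 0)
          ∂(lambertNoise (Fin 3)) :=
        (lintegral_tsum fun n => (measurable_piece hK n hg).aemeasurable).symm
    _ = ∫⁻ ξs, (∫⁻ ηs, H (lambertFlow G ε ξs z t, ηs) ∂(lambertNoise (Fin 3)))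
          ∂(lambertNoise (Fin 3)) :=
        lintegral_congr fun ξs => tsum_ite_eq' (lambertCount G ε ξs z t) fun _ =>
          ∫⁻ ηs, H (lambertFlow G ε ξs z t, ηs) ∂(lambertNoise (Fin 3))

end Summit.AtomisticToContinuum.HydrodynamicLimit.Theorems.LambertianContactSwapLambertianEulerFreshTail

end
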